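import Literature.Probability.Percolation.ArmSeparationExtSpoke
import Literature.Probability.Percolation.ArmSeparationRotate
import Literature.Probability.Percolation.ArmSeparationInnerFrames
import HarnessLib

/-!
# The reflected frames `ρ^a ∘ σ` and their spoke junctions

Topic `Literature/Probability/Percolation`; family `crit-perc` / near-critical percolation on `𝕋`.
A brick of the near-critical arm-separation theorem for four arms in the ADJACENT colour
arrangement (P. Nolin, EJP 13 (2008), Thm. 11, `j = 4`, `σ = BBWW` [arXiv 0711.4948: Thm. 10]),
landing step with a rotation chosen per slot: the exits of `ω` (read through the six frames
`frameIso i`) are read from the rotated configuration through one of the TWELVE symmetries of `𝕋`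
fixing the origin, `ρ^a` (the tree's `rotConfig a`, junction `SpokeMeetsRot`) or `ρ^a ∘ σ`
(`σ` the transposition) — the latter family is set up here:

* `rswIso a = σ ≫ ρ^a`, `rswConfig a ω = {v | ρ^a (σ v) ∈ ω}`, `rsw_apply_formula`,
  `pathIn_of_rswConfig`, `real_preimage_rswConfig`;
* `SpokeMeetsRS a Sp E` — the junction condition for a horizontal tube `Sp` of the reading
  `rswConfig a` and a tube `E` of the original frame (read in the original frame, the spoke is a
  vertical tube (`a = 0, 3`) or a thin slanted strip (`a = 1, 2, 4, 5`) and `E` lies across it like a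
  plus sign);
* `spoke_junctionRS` — every crossing of `Sp` is joined to the crossing of `E` inside
  `rswIso a '' Sp.box ∪ E.box` (as the tree's `spoke_junction` / `arm_to_entry`).

Everything here is proved.

## References

* P. Nolin, Near-critical percolation in two dimensions, *Electron. J. Probab.* 13 (2008), §4.3
  Prop. 12 (proof), §4.4 (arXiv 0711.4948: Prop. 11; proof of Thm. 10) [Nolin2008].
* H. Kesten, *Percolation theory for mathematicians* (1982), §2.2 [KestenPTM1982].
-/

noncomputable section

open MeasureTheory Set

namespace Literature.Probability.Percolation

open LatticeModels Tube

/-! ### The reflected frames -/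

/-- **The symmetry `ρ^a ∘ σ`** of `𝕋` (transpose, then rotate by `a · 60°`). [folklore] -/
def rswIso (a : ℕ) : triGraph ≃g triGraph := triSwapIso.trans (triRotIsoPow a)

/-- `rswIso a v = ρ^a (σ v)`. [folklore] -/
theorem rswIso_apply (a : ℕ) (v : Site 2) : rswIso a v = triRotIsoPow a (triSwapIso v) := rfl

/-- **The configuration read through `ρ^a ∘ σ`**: `rswConfig a ω = {v | ρ^a (σ v) ∈ ω}`. [folklore] -/
def rswConfig (a : ℕ) (ω : SiteConfig (Site 2)) : SiteConfig (Site 2) :=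
  SiteConfig.relabel (rswIso a).symm.toEquiv ω

/-- Membership in the reflected-frame configuration. [folklore] -/
@[simp] theorem mem_rswConfig {a : ℕ} {ω : SiteConfig (Site 2)} {v : Site 2} :
    v ∈ rswConfig a ω ↔ rswIso a v ∈ ω := by
  rw [rswConfig, SiteConfig.mem_relabel_iff]; rfl

/-- Reading through `ρ^a ∘ σ` is measure preserving. [folklore] -/
theorem real_preimage_rswConfig (p : unitInterval) (a : ℕ) (E : Set (SiteConfig (Site 2))) :
    (triSitePercolation p).real (rswConfig a ⁻¹' E) = (triSitePercolation p).real E := by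
  unfold triSitePercolation
  exact sitePercolation_real_preimage_relabel _ p E

/-- Coordinates of `rswIso a v`, `a < 6`. [folklore] -/
theorem rsw_apply_formula (v : Site 2) :
    (rswIso 0 v) 0 = v 1 ∧ (rswIso 0 v) 1 = v 0 ∧
    (rswIso 1 v) 0 = -v 0 ∧ (rswIso 1 v) 1 = v 1 + v 0 ∧
    (rswIso 2 v) 0 = -(v 1 + v 0) ∧ (rswIso 2 v) 1 = v 1 ∧
    (rswIso 3 v) 0 = -v 1 ∧ (rswIso 3 v) 1 = -v 0 ∧
    (rswIso 4 v) 0 = v 0 ∧ (rswIso 4 v) 1 = -(v 1 + v 0) ∧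
    (rswIso 5 v) 0 = v 1 + v 0 ∧ (rswIso 5 v) 1 = -v 1 := by
  have h0 : (triSwapIso v) 0 = v 1 := by rw [triSwapIso_apply, transposeIso_apply_zero]
  have h1 : (triSwapIso v) 1 = v 0 := by rw [triSwapIso_apply, transposeIso_apply_one]
  obtain ⟨f00, f01, f10, f11, f20, f21, f30, f31, f40, f41, f50, f51⟩ := rot_apply_formula (triSwapIso v)
  simp only [rswIso_apply]
  rw [f00, f01, f10, f11, f20, f21, f30, f31, f40, f41, f50, f51, h0, h1]
  exact ⟨rfl, rfl, rfl, rfl, rfl, rfl, rfl, rfl, rfl, rfl, rfl, rfl⟩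

/-- **Back to the original frame**: a path of colour `b` of `rswConfig a ω` inside `A` is carried by
`rswIso a` to a path of colour `b` of `ω` inside `rswIso a '' A`. [folklore] -/
theorem pathIn_of_rswConfig (a : ℕ) {A : Set (Site 2)} {ω : SiteConfig (Site 2)} {b : Bool} {x y : Site 2}
    (h : PathIn triGraph (A ∩ {v | v ∈ rswConfig a ω ↔ b}) x y) :
    PathIn triGraph ((rswIso a '' A) ∩ {v | v ∈ ω ↔ b}) (rswIso a x) (rswIso a y) := by
  refine (pathIn_map_iso (rswIso a) h).mono ?_
  rintro w ⟨v, ⟨hv, hvω⟩, rfl⟩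
  refine ⟨⟨v, hv, rfl⟩, ?_⟩
  simp only [Set.mem_setOf_eq, mem_rswConfig] at hvω ⊢
  exact hvω

/-! ### The junction condition -/

/-- **The spoke of the reflected frame `a` meets the tube `E` of the original frame**: read in the
original frame, the horizontal tube `Sp` of `rswConfig a` is the transposed (vertical) tube
(`a = 0`), its central reflection (`a = 3`), or a thin slanted strip (`a = 1, 2, 4, 5`); `E` lies
across it like a plus sign. [cite: Nolin2008, §4.3 Prop. 12 (proof) (arXiv 0711.4948: Prop. 11)] -/
def SpokeMeetsRS (a : ℕ) (Sp E : Tube) : Prop :=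
  match a with
  | 0 => E.horiz = true ∧ E.a ≤ Sp.b ∧ Sp.b + Sp.h ≤ E.a + E.w ∧ Sp.a ≤ E.b ∧ E.b + E.h ≤ Sp.a + Sp.w
  | 1 => E.horiz = false ∧ -(Sp.a + Sp.w) ≤ E.a ∧ E.a + E.w ≤ -Sp.a ∧ E.b ≤ Sp.b - (E.a + E.w) ∧
      Sp.b + Sp.h - E.a ≤ E.b + E.h
  | 2 => E.horiz = false ∧ -(Sp.a + Sp.w) - Sp.b ≤ E.a ∧ E.a + E.w ≤ -Sp.a - (Sp.b + Sp.h) ∧ E.b ≤ Sp.b ∧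
      Sp.b + Sp.h ≤ E.b + E.h
  | 3 => E.horiz = true ∧ E.a ≤ -(Sp.b + Sp.h) ∧ -Sp.b ≤ E.a + E.w ∧ -(Sp.a + Sp.w) ≤ E.b ∧ E.b + E.h ≤ -Sp.a
  | 4 => E.horiz = false ∧ Sp.a ≤ E.a ∧ E.a + E.w ≤ Sp.a + Sp.w ∧ E.b ≤ -(Sp.b + Sp.h) - (E.a + E.w) ∧
      -Sp.b - E.a ≤ E.b + E.h
  | 5 => E.horiz = false ∧ Sp.a + Sp.b + Sp.h ≤ E.a ∧ E.a + E.w ≤ Sp.a + Sp.w + Sp.b ∧ E.b ≤ -(Sp.b + Sp.h) ∧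
      -Sp.b ≤ E.b + E.h
  | _ => False

/-- **The spoke–entry junction in the reflected frames.** For `a < 6`, a horizontal tube `Sp`
crossed in `rswConfig a χ` from `x'` to `y'` and a tube `E` of the original frame crossed in `χ`
from `xE` with `SpokeMeetsRS a Sp E`: `rswIso a x'` is joined to `xE` inside
`rswIso a '' Sp.box ∪ E.box`. [cite: Nolin2008, §4.3 Prop. 12 (proof) (arXiv 0711.4948: Prop. 11)] [cite: KestenPTM1982, §2.2] -/
theorem spoke_junctionRS {a : ℕ} (ha : a < 6) {Sp E : Tube} (hSph : Sp.horiz = true) {χ : SiteConfig (Site 2)}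
    {x' y' : Site 2} (hcr : Sp.IsCrossing (rswConfig a χ) x' y')
    {xE yE : Site 2} (hE : E.IsCrossing χ xE yE) (hJ : SpokeMeetsRS a Sp E) :
    PathIn triGraph ((rswIso a '' Sp.box ∪ E.box) ∩ χ) (rswIso a x') xE := by
  obtain ⟨hs, P'⟩ := hcr
  rw [hSph] at hs
  simp only [cond_true] at hs
  have hx'b : x' ∈ Sp.box := P'.left_mem.1
  have hy'b : y' ∈ Sp.box := P'.right_mem.1
  rw [Tube.mem_box] at hx'b hy'b
  have Pphys : PathIn triGraph ((rswIso a '' Sp.box) ∩ {v | v ∈ χ ↔ true}) (rswIso a x') (rswIso a y') :=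
    pathIn_of_rswConfig a (P'.mono fun v hv => ⟨hv.1, by simpa using hv.2⟩)
  obtain ⟨S, hS, PS, TS⟩ := Pphys.exists_support
  have hSχ : S ⊆ χ := fun v hv => by simpa using (hS hv).2
  have star : ∀ u ∈ S, ∀ v ∈ S, PathIn triGraph S u v := fun u hu v hv => (TS u hu).symm.trans (TS v hv)
  obtain ⟨SE, hSE, PE, TE⟩ := hE.2.exists_support
  have physS : ∀ v ∈ S, ∃ u ∈ Sp.box, rswIso a u = v := fun v hv => by
    obtain ⟨⟨u, hu, huv⟩, -⟩ := hS hv; exact ⟨u, hu, huv⟩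
  have hEbox : ∀ z ∈ SE, E.a ≤ z 0 ∧ z 0 ≤ E.a + E.w ∧ E.b ≤ z 1 ∧ z 1 ≤ E.b + E.h := fun z hz =>
    (Tube.mem_box E).1 (hSE hz).1
  have hE1 := hE.1
  have meet : ∃ z, z ∈ S ∧ z ∈ SE := by
    interval_cases a
    · -- `σ`: the spoke is the vertical tube `[b, b+h] × [a, a+w]`; `E` horizontal
      obtain ⟨hEh, h1, h2, h3, h4⟩ := hJ
      rw [hEh] at hE1
      obtain ⟨hxE, hyE⟩ : xE 0 = E.a ∧ yE 0 = E.a + E.w := hE1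
      obtain ⟨fx0, fx1, -⟩ := rsw_apply_formula x'
      obtain ⟨fy0, fy1, -⟩ := rsw_apply_formula y'
      obtain ⟨z, hzE, hzS⟩ := exists_mem_of_cross (L := Sp.b) (R := Sp.b + Sp.h) (B := E.b) (T := E.b + E.h)
        (by omega) (by omega) PE (by omega) (by omega) (fun z hz _ _ => ⟨(hEbox z hz).2.2.1, (hEbox z hz).2.2.2⟩)
        PS (by rw [fx1]; omega) (by rw [fy1]; omega) (fun z hz _ _ => by
          obtain ⟨u, hu, rfl⟩ := physS z hz
          obtain ⟨g0, g1, -⟩ := rsw_apply_formula u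
          rw [Tube.mem_box] at hu; rw [g0]; constructor <;> omega)
      exact ⟨z, hzS, hzE⟩
    · -- `ρ ∘ σ`: `u = -x`, `u + w = y`; `E` vertical
      obtain ⟨hEh, h1, h2, h3, h4⟩ := hJ
      rw [hEh] at hE1
      obtain ⟨hxE, hyE⟩ : xE 1 = E.b ∧ yE 1 = E.b + E.h := hE1
      obtain ⟨-, -, fx0, fx1, -⟩ := rsw_apply_formula x'
      obtain ⟨-, -, fy0, fy1, -⟩ := rsw_apply_formula y'
      refine exists_mem_of_cross (L := E.a) (R := E.a + E.w) (B := E.b) (T := E.b + E.h) (by omega) (by omega)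
        PS.symm (by rw [fy0]; omega) (by rw [fx0]; omega) (fun z hz hz1 hz2 => ?_) PE (by omega) (by omega)
        (fun z hz _ _ => ⟨(hEbox z hz).1, (hEbox z hz).2.1⟩)
      obtain ⟨u, hu, rfl⟩ := physS z hz
      obtain ⟨-, -, g0, g1, -⟩ := rsw_apply_formula u
      rw [Tube.mem_box] at hu; rw [g0] at hz1 hz2; rw [g1]; constructor <;> omega
    · -- `ρ² ∘ σ`: `u = -(x + y)`, `w = y`; `E` vertical
      obtain ⟨hEh, h1, h2, h3, h4⟩ := hJ
      rw [hEh] at hE1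
      obtain ⟨hxE, hyE⟩ : xE 1 = E.b ∧ yE 1 = E.b + E.h := hE1
      obtain ⟨-, -, -, -, fx0, fx1, -⟩ := rsw_apply_formula x'
      obtain ⟨-, -, -, -, fy0, fy1, -⟩ := rsw_apply_formula y'
      refine exists_mem_of_cross (L := E.a) (R := E.a + E.w) (B := E.b) (T := E.b + E.h) (by omega) (by omega)
        PS.symm (by rw [fy0]; omega) (by rw [fx0]; omega) (fun z hz hz1 hz2 => ?_) PE (by omega) (by omega)
        (fun z hz _ _ => ⟨(hEbox z hz).1, (hEbox z hz).2.1⟩)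
      obtain ⟨u, hu, rfl⟩ := physS z hz
      obtain ⟨-, -, -, -, g0, g1, -⟩ := rsw_apply_formula u
      rw [Tube.mem_box] at hu; rw [g1]; constructor <;> omega
    · -- `-σ`: the reflected vertical tube; `E` horizontal
      obtain ⟨hEh, h1, h2, h3, h4⟩ := hJ
      rw [hEh] at hE1
      obtain ⟨hxE, hyE⟩ : xE 0 = E.a ∧ yE 0 = E.a + E.w := hE1
      obtain ⟨-, -, -, -, -, -, fx0, fx1, -⟩ := rsw_apply_formula x'
      obtain ⟨-, -, -, -, -, -, fy0, fy1, -⟩ := rsw_apply_formula y'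
      obtain ⟨z, hzE, hzS⟩ := exists_mem_of_cross (L := -(Sp.b + Sp.h)) (R := -Sp.b) (B := E.b) (T := E.b + E.h)
        (by omega) (by omega) PE (by omega) (by omega) (fun z hz _ _ => ⟨(hEbox z hz).2.2.1, (hEbox z hz).2.2.2⟩)
        PS.symm (by rw [fy1]; omega) (by rw [fx1]; omega) (fun z hz _ _ => by
          obtain ⟨u, hu, rfl⟩ := physS z hz
          obtain ⟨-, -, -, -, -, -, g0, g1, -⟩ := rsw_apply_formula u
          rw [Tube.mem_box] at hu; rw [g0]; constructor <;> omega)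
      exact ⟨z, hzS, hzE⟩
    · -- `ρ⁴ ∘ σ`: `u = x`, `w = -(x + y)`; `E` vertical
      obtain ⟨hEh, h1, h2, h3, h4⟩ := hJ
      rw [hEh] at hE1
      obtain ⟨hxE, hyE⟩ : xE 1 = E.b ∧ yE 1 = E.b + E.h := hE1
      obtain ⟨-, -, -, -, -, -, -, -, fx0, fx1, -⟩ := rsw_apply_formula x'
      obtain ⟨-, -, -, -, -, -, -, -, fy0, fy1, -⟩ := rsw_apply_formula y'
      refine exists_mem_of_cross (L := E.a) (R := E.a + E.w) (B := E.b) (T := E.b + E.h) (by omega) (by omega)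
        PS (by rw [fx0]; omega) (by rw [fy0]; omega) (fun z hz hz1 hz2 => ?_) PE (by omega) (by omega)
        (fun z hz _ _ => ⟨(hEbox z hz).1, (hEbox z hz).2.1⟩)
      obtain ⟨u, hu, rfl⟩ := physS z hz
      obtain ⟨-, -, -, -, -, -, -, -, g0, g1, -⟩ := rsw_apply_formula u
      rw [Tube.mem_box] at hu; rw [g0] at hz1 hz2; rw [g1]; constructor <;> omega
    · -- `ρ⁵ ∘ σ`: `u = x + y`, `w = -y`; `E` vertical
      obtain ⟨hEh, h1, h2, h3, h4⟩ := hJ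
      rw [hEh] at hE1
      obtain ⟨hxE, hyE⟩ : xE 1 = E.b ∧ yE 1 = E.b + E.h := hE1
      obtain ⟨-, -, -, -, -, -, -, -, -, -, fx0, fx1⟩ := rsw_apply_formula x'
      obtain ⟨-, -, -, -, -, -, -, -, -, -, fy0, fy1⟩ := rsw_apply_formula y'
      refine exists_mem_of_cross (L := E.a) (R := E.a + E.w) (B := E.b) (T := E.b + E.h) (by omega) (by omega)
        PS (by rw [fx0]; omega) (by rw [fy0]; omega) (fun z hz hz1 hz2 => ?_) PE (by omega) (by omega)
        (fun z hz _ _ => ⟨(hEbox z hz).1, (hEbox z hz).2.1⟩)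
      obtain ⟨u, hu, rfl⟩ := physS z hz
      obtain ⟨-, -, -, -, -, -, -, -, -, -, g0, g1⟩ := rsw_apply_formula u
      rw [Tube.mem_box] at hu; rw [g1]; constructor <;> omega
  obtain ⟨z, hzS, hzE⟩ := meet
  have Q2 : PathIn triGraph ((rswIso a '' Sp.box ∪ E.box) ∩ χ) (rswIso a x') z := by
    refine (star _ PS.left_mem z hzS).mono fun v hv => ?_
    obtain ⟨u, hu, rfl⟩ := physS v hv
    exact ⟨Or.inl ⟨u, hu, rfl⟩, hSχ hv⟩
  have Q3 : PathIn triGraph ((rswIso a '' Sp.box ∪ E.box) ∩ χ) z xE :=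
    (TE z hzE).symm.mono fun v hv => ⟨Or.inr (hSE hv).1, (hSE hv).2⟩
  exact Q2.trans Q3

/-! ### The junction in the rotated frames `ρ^a` (generic form of `trapArm_to_entry`) -/

/-- **The spoke–entry junction in the rotated frames.** For `a < 6`, a horizontal tube `Sp`
crossed in `rotConfig a χ` from `x'` to `y'` and a tube `E` of the original frame crossed in `χ`
from `xE` with `SpokeMeetsRot a Sp E`: `ρ^a x'` is joined to `xE` inside `ρ^a '' Sp.box ∪ E.box`
(the six cases verbatim from the tree's `trapArm_to_entry`). [cite: Nolin2008, §4.3 Prop. 12 (proof) (arXiv 0711.4948: Prop. 11)] [cite: KestenPTM1982, §2.2] -/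
theorem spoke_junctionRot {a : ℕ} (ha : a < 6) {Sp E : Tube} (hSph : Sp.horiz = true) {χ : SiteConfig (Site 2)}
    {x' y' : Site 2} (hcr : Sp.IsCrossing (rotConfig a χ) x' y')
    {xE yE : Site 2} (hE : E.IsCrossing χ xE yE) (hJ : SpokeMeetsRot a Sp E) :
    PathIn triGraph ((triRotIsoPow a '' Sp.box ∪ E.box) ∩ χ) (triRotIsoPow a x') xE := by
  obtain ⟨hs, P'⟩ := hcr
  rw [hSph] at hs
  simp only [cond_true] at hs
  have hx'b : x' ∈ Sp.box := P'.left_mem.1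
  have hy'b : y' ∈ Sp.box := P'.right_mem.1
  rw [Tube.mem_box] at hx'b hy'b
  have Pphys : PathIn triGraph ((triRotIsoPow a '' Sp.box) ∩ {v | v ∈ χ ↔ true}) (triRotIsoPow a x') (triRotIsoPow a y') :=
    pathIn_of_rotConfig a (P'.mono fun v hv => ⟨hv.1, by simpa using hv.2⟩)
  obtain ⟨S, hS, PS, TS⟩ := Pphys.exists_support
  have hSχ : S ⊆ χ := fun v hv => by simpa using (hS hv).2
  have star : ∀ u ∈ S, ∀ v ∈ S, PathIn triGraph S u v := fun u hu v hv => (TS u hu).symm.trans (TS v hv)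
  obtain ⟨SE, hSE, PE, TE⟩ := hE.2.exists_support
  have physS : ∀ v ∈ S, ∃ q ∈ Sp.box, triRotIsoPow a q = v := fun v hv => by
    obtain ⟨⟨q, hq, hqv⟩, -⟩ := hS hv; exact ⟨q, hq, hqv⟩
  have hEbox : ∀ z ∈ SE, E.a ≤ z 0 ∧ z 0 ≤ E.a + E.w ∧ E.b ≤ z 1 ∧ z 1 ≤ E.b + E.h := fun z hz =>
    (Tube.mem_box E).1 (hSE hz).1
  have hE1 := hE.1
  have meet : ∃ z, z ∈ S ∧ z ∈ SE := by
    interval_cases a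
    · obtain ⟨hEh, h1, h2, h3, h4⟩ := hJ
      rw [hEh] at hE1
      obtain ⟨hxE, hyE⟩ : xE 1 = E.b ∧ yE 1 = E.b + E.h := hE1
      obtain ⟨fx0, -⟩ := rot_apply_formula x'
      obtain ⟨fy0, -⟩ := rot_apply_formula y'
      refine exists_mem_of_cross (L := E.a) (R := E.a + E.w) (B := E.b) (T := E.b + E.h) (by omega) (by omega)
        PS (by rw [fx0]; omega) (by rw [fy0]; omega) (fun z hz _ _ => ?_) PE (by omega) (by omega)
        (fun z hz _ _ => ⟨(hEbox z hz).1, (hEbox z hz).2.1⟩)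
      obtain ⟨q, hq, rfl⟩ := physS z hz
      obtain ⟨g0, g1, -⟩ := rot_apply_formula q
      rw [Tube.mem_box] at hq; rw [g0, g1] at *; constructor <;> omega
    · obtain ⟨hEh, h1, h2, h3, h4⟩ := hJ
      rw [hEh] at hE1
      obtain ⟨hxE, hyE⟩ : xE 0 = E.a ∧ yE 0 = E.a + E.w := hE1
      obtain ⟨-, -, fx0, fx1, -⟩ := rot_apply_formula x'
      obtain ⟨-, -, fy0, fy1, -⟩ := rot_apply_formula y'
      obtain ⟨z, hzE, hzS⟩ := exists_mem_of_cross (L := -(Sp.b + Sp.h)) (R := -Sp.b) (B := E.b) (T := E.b + E.h)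
        (by omega) (by omega) PE (by omega) (by omega) (fun z hz _ _ => ⟨(hEbox z hz).2.2.1, (hEbox z hz).2.2.2⟩)
        PS (by rw [fx1]; omega) (by rw [fy1]; omega) (fun z hz _ _ => by
          obtain ⟨q, hq, rfl⟩ := physS z hz
          obtain ⟨-, -, g0, g1, -⟩ := rot_apply_formula q
          rw [Tube.mem_box] at hq; rw [g0]; constructor <;> omega)
      exact ⟨z, hzS, hzE⟩
    · obtain ⟨hEh, h1, h2, h3, h4⟩ := hJ
      rw [hEh] at hE1
      obtain ⟨hxE, hyE⟩ : xE 0 = E.a ∧ yE 0 = E.a + E.w := hE1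
      obtain ⟨-, -, -, -, fx0, fx1, -⟩ := rot_apply_formula x'
      obtain ⟨-, -, -, -, fy0, fy1, -⟩ := rot_apply_formula y'
      obtain ⟨z, hzE, hzS⟩ := exists_mem_of_cross (L := E.a) (R := E.a + E.w) (B := E.b) (T := E.b + E.h)
        (by omega) (by omega) PE (by omega) (by omega) (fun z hz _ _ => ⟨(hEbox z hz).2.2.1, (hEbox z hz).2.2.2⟩)
        PS (by rw [fx1]; omega) (by rw [fy1]; omega) (fun z hz hzlo hzhi => by
          obtain ⟨q, hq, rfl⟩ := physS z hz
          obtain ⟨-, -, -, -, g0, g1, -⟩ := rot_apply_formula q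
          rw [Tube.mem_box] at hq; rw [g0]; rw [g1] at hzlo hzhi; constructor <;> omega)
      exact ⟨z, hzS, hzE⟩
    · obtain ⟨hEh, h1, h2, h3, h4⟩ := hJ
      rw [hEh] at hE1
      obtain ⟨hxE, hyE⟩ : xE 1 = E.b ∧ yE 1 = E.b + E.h := hE1
      obtain ⟨-, -, -, -, -, -, fx0, fx1, -⟩ := rot_apply_formula x'
      obtain ⟨-, -, -, -, -, -, fy0, fy1, -⟩ := rot_apply_formula y'
      refine exists_mem_of_cross (L := E.a) (R := E.a + E.w) (B := E.b) (T := E.b + E.h) (by omega) (by omega)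
        PS.symm (by rw [fy0]; omega) (by rw [fx0]; omega) (fun z hz _ _ => ?_) PE (by omega) (by omega)
        (fun z hz _ _ => ⟨(hEbox z hz).1, (hEbox z hz).2.1⟩)
      obtain ⟨q, hq, rfl⟩ := physS z hz
      obtain ⟨-, -, -, -, -, -, g0, g1, -⟩ := rot_apply_formula q
      rw [Tube.mem_box] at hq; rw [g1]; constructor <;> omega
    · obtain ⟨hEh, h1, h2, h3, h4⟩ := hJ
      rw [hEh] at hE1
      obtain ⟨hxE, hyE⟩ : xE 0 = E.a ∧ yE 0 = E.a + E.w := hE1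
      obtain ⟨-, -, -, -, -, -, -, -, fx0, fx1, -⟩ := rot_apply_formula x'
      obtain ⟨-, -, -, -, -, -, -, -, fy0, fy1, -⟩ := rot_apply_formula y'
      obtain ⟨z, hzE, hzS⟩ := exists_mem_of_cross (L := Sp.b) (R := Sp.b + Sp.h) (B := E.b) (T := E.b + E.h)
        (by omega) (by omega) PE (by omega) (by omega) (fun z hz _ _ => ⟨(hEbox z hz).2.2.1, (hEbox z hz).2.2.2⟩)
        PS.symm (by rw [fy1]; omega) (by rw [fx1]; omega) (fun z hz _ _ => by
          obtain ⟨q, hq, rfl⟩ := physS z hz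
          obtain ⟨-, -, -, -, -, -, -, -, g0, g1, -⟩ := rot_apply_formula q
          rw [Tube.mem_box] at hq; rw [g0]; constructor <;> omega)
      exact ⟨z, hzS, hzE⟩
    · obtain ⟨hEh, h1, h2, h3, h4⟩ := hJ
      rw [hEh] at hE1
      obtain ⟨hxE, hyE⟩ : xE 0 = E.a ∧ yE 0 = E.a + E.w := hE1
      obtain ⟨-, -, -, -, -, -, -, -, -, -, fx0, fx1⟩ := rot_apply_formula x'
      obtain ⟨-, -, -, -, -, -, -, -, -, -, fy0, fy1⟩ := rot_apply_formula y'
      obtain ⟨z, hzE, hzS⟩ := exists_mem_of_cross (L := E.a) (R := E.a + E.w) (B := E.b) (T := E.b + E.h)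
        (by omega) (by omega) PE (by omega) (by omega) (fun z hz _ _ => ⟨(hEbox z hz).2.2.1, (hEbox z hz).2.2.2⟩)
        PS.symm (by rw [fy1]; omega) (by rw [fx1]; omega) (fun z hz hzlo hzhi => by
          obtain ⟨q, hq, rfl⟩ := physS z hz
          obtain ⟨-, -, -, -, -, -, -, -, -, -, g0, g1⟩ := rot_apply_formula q
          rw [Tube.mem_box] at hq; rw [g0]; rw [g1] at hzlo hzhi; constructor <;> omega)
      exact ⟨z, hzS, hzE⟩
  obtain ⟨z, hzS, hzE⟩ := meet
  have Q2 : PathIn triGraph ((triRotIsoPow a '' Sp.box ∪ E.box) ∩ χ) (triRotIsoPow a x') z := by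
    refine (star _ PS.left_mem z hzS).mono fun v hv => ?_
    obtain ⟨q, hq, rfl⟩ := physS v hv
    exact ⟨Or.inl ⟨q, hq, rfl⟩, hSχ hv⟩
  have Q3 : PathIn triGraph ((triRotIsoPow a '' Sp.box ∪ E.box) ∩ χ) z xE :=
    (TE z hzE).symm.mono fun v hv => ⟨Or.inr (hSE hv).1, (hSE hv).2⟩
  exact Q2.trans Q3

end Literature.Probability.Percolation
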